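import Mathlib
import HarnessLib
import Summits.Ventures.LatticeQCDFlow.Exactness.SUNStoutLayerClassFunction
import Summits.Ventures.LatticeQCDFlow.Exactness.InversePassJacobian

/-!
# The INVERSE pass of the masked `SU(N)` stout layer is exact, with a continuous positive class-function Jacobian `1/(j ∘ Ψ⁻¹)`

HONEST FRAMING: exact (Metropolis-corrected) sampling algorithms for lattice gauge theory;
figures of merit are autocorrelation/cost numbers at stated couplings and volumes; no
continuum-physics claim.

Venture `LatticeQCDFlow` (cell pub-lqcd), topic `Exactness`; FANOUT row 10 (`eng-equiv`; engine
`equiv/residual.py` `inverse` (certified fixed-point inversion under the κ < 1 guard), `flows_jax`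
`flow_inverse` / `scan` inverse, which book `−ldj` on the inverse pass; unit tests "invertibility
round-trip < 1e-8", "Jacobian(inverse)·Jacobian(forward) = 1 to 1.3e-15").  NEW WORK of the cell over
`InversePassJacobian.HasJacobian.symm_ofReal` (inverse of an exact automorphism is exact with the
reciprocal Jacobian), `SUNStoutLatticeLayer` (the stout layer is a homeomorphism and a measurable
automorphism), `SUNStoutLayerClassFunction` (its continuous exact Jacobians are class functions) and
`EquivariantJacobianGaugeInvariance.isGaugeInvariant_jac_comp_symm`.  Nothing is cited as a fact; no
number; no definition.

* `continuous_measurableEquiv_symm_of_isHomeomorph` — if a measurable automorphism's forward map is a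
  homeomorphism, its inverse map is continuous (inverse uniqueness);
* **`inversePass_sunStoutLatticeLayer`** — every `N`, `d`, `L`, mask meeting `h1`–`h6`, continuous
  gauge-invariant frozen-link coefficient with `2(d−1)|R| < 1`: for the stout layer presented as
  `Ψ : GaugeConfig ≃ᵐ GaugeConfig` and ANY continuous exact Jacobian `j > 0` of it, the inverse layer
  `Ψ⁻¹` has the exact Jacobian `U ↦ 1 / j(Ψ⁻¹ U)` for product Haar, and that Jacobian is CONTINUOUS,
  POSITIVE and a CLASS FUNCTION — the inverse pass is an exact, gauge-covariant flow layer in its own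
  right (so inverse-direction samplers / density evaluations through the stout layer are exact too).
-/

noncomputable section

namespace Summit.Ventures.LatticeQCDFlow.Exactness

open Literature.MathematicalPhysics.QuantumFieldTheory
open Literature.MathematicalPhysics.QuantumFieldTheory.Luscher2010
open MeasureTheory
open scoped Matrix ENNReal

/-- **The inverse of a measurable automorphism whose forward map is a homeomorphism is continuous**
(the set-theoretic inverse is unique, so it is the homeomorphism's inverse). -/
theorem continuous_measurableEquiv_symm_of_isHomeomorph {Ω : Type*} [MeasurableSpace Ω] [TopologicalSpace Ω]
    (Ψ : Ω ≃ᵐ Ω) (hΨ : IsHomeomorph (Ψ : Ω → Ω)) : Continuous (Ψ.symm : Ω → Ω) := by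
  have heq : (Ψ.symm : Ω → Ω) = (hΨ.homeomorph (Ψ : Ω → Ω)).symm := by
    funext x
    apply Ψ.injective
    rw [Ψ.apply_symm_apply]
    exact ((hΨ.homeomorph (Ψ : Ω → Ω)).apply_symm_apply x).symm
  rw [heq]
  exact (hΨ.homeomorph (Ψ : Ω → Ω)).symm.continuous

variable {d L n : ℕ} [NeZero L]

/-- **The inverse pass of the masked `SU(N)` stout layer is exact with a continuous positive
class-function Jacobian.**  `Ψ` the stout layer as a measurable automorphism (`⇑Ψ =` the layer),
`j > 0` continuous with `HasJacobian (⊗Haar) Ψ (ofReal ∘ j)`; then for `k U = (j (Ψ⁻¹ U))⁻¹`: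
`HasJacobian (⊗Haar) Ψ⁻¹ (ofReal ∘ k)`, `k` continuous, `k > 0`, `k` gauge invariant. -/
theorem inversePass_sunStoutLatticeLayer (p : Edge d L → Prop) [DecidablePred p]
    (ρ : GaugeConfig d L (Matrix.specialUnitaryGroup (Fin n) ℂ) → Edge d L → ℝ)
    (R : (e : Edge d L) → ({f : Edge d L // ¬p f} → Matrix.specialUnitaryGroup (Fin n) ℂ) → ℝ)
    (hR : ∀ V e, p e → ρ V e = R e (fun f => V f)) (hRc : ∀ e, p e → Continuous (R e))
    (hρg : ∀ (g : Site d L → Matrix.specialUnitaryGroup (Fin n) ℂ)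
      (V : GaugeConfig d L (Matrix.specialUnitaryGroup (Fin n) ℂ)) (e : Edge d L), p e →
        ρ (gaugeTransform g V) e = ρ V e)
    (h1 : ∀ e, p e → ∀ ν, ν ≠ e.2 → ¬p (e.1.shift e.2, ν))
    (h2 : ∀ e, p e → ∀ ν, ν ≠ e.2 → ¬p (e.1.shift ν, e.2))
    (h3 : ∀ e, p e → ∀ ν, ν ≠ e.2 → ¬p (e.1, ν))
    (h4 : ∀ e, p e → ∀ ν, ν ≠ e.2 → ¬p ((e.1 - Pi.single ν 1).shift e.2, ν))
    (h5 : ∀ e, p e → ∀ ν, ν ≠ e.2 → ¬p (e.1 - Pi.single ν 1, e.2))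
    (h6 : ∀ e, p e → ∀ ν, ν ≠ e.2 → ¬p (e.1 - Pi.single ν 1, ν))
    (hκ : ∀ e y, p e → 2 * (d - 1 : ℝ) * |R e y| < 1)
    (Ψ : GaugeConfig d L (Matrix.specialUnitaryGroup (Fin n) ℂ) ≃ᵐ GaugeConfig d L (Matrix.specialUnitaryGroup (Fin n) ℂ))
    (hΨ : ⇑Ψ = fun (V : GaugeConfig d L (Matrix.specialUnitaryGroup (Fin n) ℂ)) (e : Edge d L) =>
      if p e then
        (⟨NormedSpace.exp ((ρ V e : ℂ) • suProj (plaquetteLoopSum V e.1 e.2)),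
            exp_smul_suProj_mem (ρ V e) (plaquetteLoopSum V e.1 e.2)⟩ :
          Matrix.specialUnitaryGroup (Fin n) ℂ) * V e
      else V e)
    {j : GaugeConfig d L (Matrix.specialUnitaryGroup (Fin n) ℂ) → ℝ} (hj : Continuous j) (hj0 : ∀ U, 0 < j U)
    (h : HasJacobian (Measure.pi fun _ : Edge d L => haarProbability (Matrix.specialUnitaryGroup (Fin n) ℂ)) Ψ
      (fun U => ENNReal.ofReal (j U))) :
    HasJacobian (Measure.pi fun _ : Edge d L => haarProbability (Matrix.specialUnitaryGroup (Fin n) ℂ)) Ψ.symm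
        (fun U => ENNReal.ofReal (j (Ψ.symm U))⁻¹) ∧
      Continuous (fun U => (j (Ψ.symm U))⁻¹) ∧ (∀ U, 0 < (j (Ψ.symm U))⁻¹) ∧
      IsGaugeInvariant (fun U => (j (Ψ.symm U))⁻¹) := by
  -- continuity of the inverse map: the layer is a homeomorphism
  have hhom : IsHomeomorph (Ψ : GaugeConfig d L (Matrix.specialUnitaryGroup (Fin n) ℂ) →
      GaugeConfig d L (Matrix.specialUnitaryGroup (Fin n) ℂ)) := by
    rw [hΨ]
    exact isHomeomorph_sunStoutLatticeLayer p ρ R hR hRc h1 h2 h3 h4 h5 h6 hκ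
  have hsymm : Continuous (Ψ.symm : GaugeConfig d L (Matrix.specialUnitaryGroup (Fin n) ℂ) →
      GaugeConfig d L (Matrix.specialUnitaryGroup (Fin n) ℂ)) :=
    continuous_measurableEquiv_symm_of_isHomeomorph Ψ hhom
  -- the forward Jacobian is a class function, the layer equivariant
  have hjinv : IsGaugeInvariant j :=
    isGaugeInvariant_jacobian_sunStoutLatticeLayer p ρ R hR hRc hρg h1 h2 h3 h4 h5 h6 hκ hΨ hj
      (fun U => (hj0 U).le) h
  have hequiv : IsGaugeEquivariant (Ψ : GaugeConfig d L (Matrix.specialUnitaryGroup (Fin n) ℂ) →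
      GaugeConfig d L (Matrix.specialUnitaryGroup (Fin n) ℂ)) := by
    rw [hΨ]
    exact isGaugeEquivariant_sunStoutLayer p ρ hρg
  refine ⟨h.symm_ofReal hj0, (hj.comp hsymm).inv₀ fun U => (hj0 _).ne', fun U => inv_pos.mpr (hj0 _), ?_⟩
  have hcomp : IsGaugeInvariant fun U => j (Ψ.symm U) := isGaugeInvariant_jac_comp_symm hequiv hjinv
  intro g U
  simp only [hcomp g U]

end Summit.Ventures.LatticeQCDFlow.Exactness

end
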